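import Summits.RiemannHypothesis.RiemannHypothesis.Theorems.ScrewManifestCornerGapProof
import Summits.RiemannHypothesis.RiemannHypothesis.Theorems.ScrewManifestFactorRichLags
import HarnessLib

/-!
# RH-FREE: the superlinear floor from the J-bound ALONE (`JBound → SuperlinearFloor`), bypassing S2 `PlateauBound`

sos-theory note 3 (SCREW-P3-PLATEAU-NOTE-g20 §3, BYPASS): with the divisor-pair identity
(`diag_bounds_of_factorRich`, p477076) the diagonal of every FACTOR-RICH row of a strictly diagonally
dominant manifest remainder is `< 2wJ`, so the corner-gap contradiction can be run on near pairs of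
factor-rich rows (`factorRichLagDensity`, L3′) with the single scalar hypothesis `wJ = O_θ(1/N)`.
With L2 a theorem (`cornerGap_holds`, p476632) this gives, WITHOUT the plateau slot S2 and without the
corner-cost-law detour:

* `superlinearFloor_of_smallJ` : if for every slope `θ` there is `A` such that every `n` carrying SOME
  manifest certificate at height `θ(n+1)` carries one with all-ones weight `wJ ≤ A/(n+1)` (sos-theory's
  `JBoundMin`, spelled inline), then `SuperlinearFloor`;
* `superlinearFloor_of_jBound : JBound → SuperlinearFloor` (S2a alone suffices).

Proof: a certificate at height `C(n+1) ≤ θ(n+1)`, `θ = max C 1`, with `wJ ≤ A/N`: strict DD gives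
`0 < R_ii` and `|R_ij| < R_ii`, factor-richness gives `R_ii < 2wJ ≤ 2A/N`, so by `remainder_offdiag_eq`
`|N·η(node i − node j)| ≤ 4|A|` at every factor-rich pair; the uniform cusp bound
(`abs_mul_zetaScrew_div_sub_le`) then puts the rescaled atom sum within `(15 + 4|A|)/log N` of `s/2` at
every factor-rich scaled near lag in `[1,3]`, a `δ`-dense set — contradicting `cornerGap_holds` once
`log N > (15 + 4|A|)/ε`.

RH-FREE statements about the certificate FORMAT; nothing here bears on the truth of RH.  References:
[folklore]; plan: sos-theory note 3 §3.
-/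

set_option linter.dupNamespace false
set_option autoImplicit false

noncomputable section

open Real Set Finset

namespace Summit.RiemannHypothesis.RiemannHypothesis.Theorems.IntegerScrew.Manifest

open Literature.NumberTheory.LFunctions

set_option maxHeartbeats 400000 in
/-- **RH-free superlinear floor from a small all-ones weight** (sos-theory's `JBoundMin`, inline): if at
every slope `θ` some constant `A` bounds `(n+1)·wJ` for at least one certificate of every certifiable
`S_{n+1}` at height `θ(n+1)`, then `SuperlinearFloor`. [folklore] -/
theorem superlinearFloor_of_smallJ
    (hJ : ∀ θ : ℝ, 0 < θ → ∃ A : ℝ, ∀ (n : ℕ) (tmin : ℝ), 0 < tmin →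
      ManifestCert n tmin (θ * (n + 1)) →
        ∃ (K : ℕ) (t w : Fin K → ℝ) (wJ : ℝ), (∀ k, 0 < t k ∧ t k ≤ θ * (n + 1) ∧ 0 ≤ w k) ∧
          0 ≤ wJ ∧ wJ ≤ A / (n + 1) ∧ IsStrictDiagDominant (remainder n K t w wJ)) :
    SuperlinearFloor := by
  classical
  intro C
  set θ : ℝ := max C 1 with hθdef
  have hθ : 0 < θ := lt_of_lt_of_le one_pos (le_max_right _ _)
  obtain ⟨ε, δ, hε, hδ, hgap⟩ := cornerGap_holds θ hθ
  obtain ⟨A, hA⟩ := hJ θ hθ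
  -- density of factor-rich near lags at the scale `δ'/2`, `δ' = min δ 1`
  set δ' : ℝ := min δ 1 with hδ'
  have hδ'0 : 0 < δ' := lt_min hδ one_pos
  have hδ'δ : δ' ≤ δ := min_le_left _ _
  have hδ'1 : δ' ≤ 1 := min_le_right _ _
  obtain ⟨M₀, hM₀⟩ := factorRichLagDensity (δ' / 2) (by positivity)
  -- the threshold: `N ≥ M₀`, `N ≥ 8`, `log N > (15 + 4|A|)/ε`
  set B : ℝ := 15 + 4 * |A| with hB
  obtain ⟨n₁, hn₁⟩ : ∃ n₁ : ℕ, B / ε < Real.log ((n₁ : ℝ) + 1) := by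
    obtain ⟨n₁, hn₁⟩ := exists_nat_gt (Real.exp (B / ε))
    refine ⟨n₁, ?_⟩
    have h' : Real.exp (B / ε) < (n₁ : ℝ) + 1 := by linarith
    calc B / ε = Real.log (Real.exp (B / ε)) := (Real.log_exp _).symm
      _ < Real.log ((n₁ : ℝ) + 1) := Real.log_lt_log (Real.exp_pos _) h'
  refine ⟨max (max M₀ 8) n₁, fun n hn tmin htmin hcert => ?_⟩
  have hM₀n : M₀ ≤ n + 1 := by omega
  have h8 : 8 ≤ n + 1 := by omega
  have hn₁n : n₁ ≤ n := le_trans (le_max_right _ _) hn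
  have hN0 : (0 : ℝ) < (n : ℝ) + 1 := by positivity
  -- the certificate at height `θ N` with small `wJ`
  have hcert' : ManifestCert n tmin (θ * (n + 1)) :=
    manifestCert_mono le_rfl (mul_le_mul_of_nonneg_right (le_max_left _ _) hN0.le) hcert
  obtain ⟨K, t, w, wJ, hatoms, hwJ, hwJA, hDD⟩ := hA n tmin htmin hcert'
  set R := remainder n K t w wJ with hR
  set N : ℝ := (n : ℝ) + 1 with hN
  have hN8 : (8 : ℝ) ≤ N := by rw [hN]; exact_mod_cast h8
  set L := Real.log N with hL
  have hL0 : 0 < L := Real.log_pos (by linarith)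
  have hLB : B < ε * L := by
    have h1 : Real.log ((n₁ : ℝ) + 1) ≤ L :=
      Real.log_le_log (by positivity) (by rw [hN]; exact_mod_cast Nat.succ_le_succ hn₁n)
    have h2 : B / ε < L := lt_of_lt_of_le hn₁ h1
    rw [div_lt_iff₀ hε] at h2
    linarith
  -- strict DD: positive diagonals dominating each entry; factor-rich rows: `R_ii < 2wJ ≤ 2A/N`
  have hRii_pos : ∀ i : Fin n, 0 < R i i := by
    intro i
    have h1 := hDD i
    have h2 : 0 ≤ ∑ j ∈ univ.erase i, |R i j| := sum_nonneg fun _ _ => abs_nonneg _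
    linarith
  have hRij : ∀ i j : Fin n, j ≠ i → |R i j| < R i i := by
    intro i j hji
    have h1 : |R i j| ≤ ∑ j' ∈ univ.erase i, |R i j'| :=
      single_le_sum (f := fun j' => |R i j'|) (fun _ _ => abs_nonneg _) (mem_erase.mpr ⟨hji, mem_univ _⟩)
    have h2 := hDD i
    linarith
  have hRii_hi : ∀ i : Fin n, FactorRich ((i : ℕ) + 2) → N * R i i ≤ 2 * |A| := by
    intro i hi
    have h1 := (diag_bounds_of_factorRich n K t w wJ hDD i hi).1
    rw [← hR] at h1
    have h2 : wJ ≤ |A| / N := le_trans hwJA (div_le_div_of_nonneg_right (le_abs_self A) hN0.le)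
    have h3 : N * wJ ≤ |A| := by
      have := mul_le_mul_of_nonneg_left h2 hN0.le
      have e : N * (|A| / N) = |A| := by field_simp
      linarith
    nlinarith
  -- the profile at factor-rich pairs: `|N·η(node i − node j)| ≤ 4|A|`
  have hη : ∀ i j : Fin n, FactorRich ((i : ℕ) + 2) → FactorRich ((j : ℕ) + 2) → (j : ℕ) < (i : ℕ) →
      |N * remainderFn K t w (node n i - node n j)| ≤ 4 * |A| := by
    intro i j hi hj hij
    have hji : j ≠ i := fun h => by rw [h] at hij; exact lt_irrefl _ hij
    have e := remainder_offdiag_eq n K t w wJ i j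
    rw [← hR] at e
    have h1 := hRii_hi i hi
    have h2 := hRii_hi j hj
    have h3 := hRii_pos i
    have h4 := hRii_pos j
    have h5 := hRij i j hji
    have hηeq : N * remainderFn K t w (node n i - node n j)
        = (N * R i i + N * R j j) / 2 - N * R i j := by rw [e]; ring
    rw [hηeq, abs_le]
    have g5 : N * |R i j| < N * R i i := mul_lt_mul_of_pos_left h5 hN0
    have g6 : |N * R i j| = N * |R i j| := by rw [abs_mul, abs_of_pos hN0]
    have g7 := le_abs_self (N * R i j)
    have g8 := neg_abs_le (N * R i j)
    have g3 : 0 < N * R i i := mul_pos hN0 h3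
    have g4 : 0 < N * R j j := mul_pos hN0 h4
    constructor
    · linarith
    · linarith
  -- the rescaled atoms
  set τ : Fin K → ℝ := fun k => t k / N with hτ
  set W : Fin K → ℝ := fun k => w k / (N * L) with hW
  have hτW : ∀ k, 0 < τ k ∧ τ k ≤ θ ∧ 0 ≤ W k := by
    intro k
    obtain ⟨ht0, htθ, hw0⟩ := hatoms k
    refine ⟨by positivity, ?_, by positivity⟩
    show t k / N ≤ θ
    rw [div_le_iff₀ hN0, hN]; linarith
  -- the point set `P` of factor-rich scaled near lags in `[1, 3]`
  set lag : Fin n × Fin n → ℝ := fun q => N * (node n q.1 - node n q.2) with hlag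
  set S : Finset (Fin n × Fin n) := univ.filter (fun q =>
    FactorRich ((q.1 : ℕ) + 2) ∧ FactorRich ((q.2 : ℕ) + 2) ∧ (q.2 : ℕ) < (q.1 : ℕ) ∧
      1 ≤ lag q ∧ lag q ≤ 3) with hS
  set P : Finset ℝ := S.image lag with hP
  have hP1 : ∀ p ∈ P, 1 ≤ p ∧ p ≤ 3 := by
    intro p hp
    obtain ⟨q, hq, rfl⟩ := mem_image.mp hp
    have h := (mem_filter.mp hq).2
    exact ⟨h.2.2.2.1, h.2.2.2.2⟩
  have hP2 : ∀ x : ℝ, 1 ≤ x → x ≤ 3 → ∃ p ∈ P, |x - p| ≤ δ := by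
    intro x hx1 hx3
    -- clamp `x` into `[1 + δ'/2, 3 − δ'/2]`
    set x' : ℝ := max (1 + δ' / 2) (min x (3 - δ' / 2)) with hx'
    have hx'1 : 1 + δ' / 2 ≤ x' := le_max_left _ _
    have hx'3 : x' ≤ 3 - δ' / 2 := max_le (by linarith) (min_le_right _ _)
    have hxx' : |x - x'| ≤ δ' / 2 := by
      rw [abs_le]
      constructor
      · have : x' ≤ x + δ' / 2 := max_le (by linarith) (le_trans (min_le_left _ _) (by linarith))
        linarith
      · have : x - δ' / 2 ≤ x' :=
          le_trans (le_min (by linarith) (by linarith)) (le_max_right _ _)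
        linarith
    obtain ⟨i, j, hij, hri, hrj, hclose⟩ := hM₀ n hM₀n x' (by linarith) (by linarith)
    rw [← hN] at hclose
    have hlagij : lag (i, j) = N * (node n i - node n j) := rfl
    obtain ⟨hc1, hc2⟩ := abs_le.mp hclose
    have hmem : (i, j) ∈ S := by
      rw [hS, mem_filter]
      refine ⟨mem_univ _, hri, hrj, hij, ?_, ?_⟩
      · rw [hlagij]; linarith
      · rw [hlagij]; linarith
    refine ⟨lag (i, j), mem_image.mpr ⟨(i, j), hmem, rfl⟩, ?_⟩
    rw [hlagij]
    have t1 := abs_sub_le x x' (N * (node n i - node n j))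
    linarith
  -- the corner gap yields a bad point, which is a factor-rich scaled near lag
  obtain ⟨s, hsP, hsε⟩ := hgap K τ W P hτW hP1 hP2
  obtain ⟨⟨i, j⟩, hq, hs⟩ := mem_image.mp hsP
  obtain ⟨hri, hrj, hij, hs1, hs3⟩ := (mem_filter.mp hq).2
  rw [hs] at hs1 hs3
  have hlagij : lag (i, j) = N * (node n i - node n j) := rfl
  rw [hlagij] at hs
  set u := node n i - node n j with hu
  -- `Φ̃(s) = (N/L)·(Ψ(u) − η(u))`
  have hΦ : (∑ k, W k * (1 - Real.cos (τ k * s)) / (τ k) ^ 2)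
      = N / L * (zetaScrew u - remainderFn K t w u) := by
    have hatoms' : zetaScrew u - remainderFn K t w u
        = ∑ k, w k * ((1 - Real.cos (t k * u)) / t k ^ 2) := by
      simp only [remainderFn]; ring
    rw [hatoms', mul_sum]
    refine sum_congr rfl fun k _ => ?_
    have htk : t k ≠ 0 := (hatoms k).1.ne'
    have e1 : τ k * s = t k * u := by
      show t k / N * s = t k * u
      rw [← hs]; field_simp
    rw [e1]
    show w k / (N * L) * (1 - Real.cos (t k * u)) / (t k / N) ^ 2
      = N / L * (w k * ((1 - Real.cos (t k * u)) / t k ^ 2))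
    field_simp
  -- the bound `|Φ̃(s) − s/2| ≤ (15 + 4|A|)/L < ε`
  have hcusp : |N * zetaScrew (s / N) - s / 2 * L| ≤ 15 :=
    abs_mul_zetaScrew_div_sub_le hs1 hs3 (by linarith)
  have hsu : s / N = u := by rw [← hs]; field_simp
  rw [hsu] at hcusp
  have hηb := hη i j hri hrj hij
  have e2 : (∑ k, W k * (1 - Real.cos (τ k * s)) / (τ k) ^ 2) - s / 2
      = ((N * zetaScrew u - s / 2 * L) - N * remainderFn K t w u) / L := by
    rw [hΦ]; field_simp; ring
  rw [e2, abs_div, abs_of_pos hL0] at hsε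
  have e3 : |(N * zetaScrew u - s / 2 * L) - N * remainderFn K t w u| ≤ B := by
    have := abs_sub (N * zetaScrew u - s / 2 * L) (N * remainderFn K t w u)
    rw [hB]; linarith
  have e4 : ε ≤ B / L := le_trans hsε (div_le_div_of_nonneg_right e3 hL0.le)
  rw [le_div_iff₀ hL0] at e4
  linarith

/-- **`JBound → SuperlinearFloor` (RH-free): the plateau slot S2 is bypassed; S2a alone suffices.** [folklore] -/
theorem superlinearFloor_of_jBound (hJ : JBound) : SuperlinearFloor := by
  refine superlinearFloor_of_smallJ fun θ hθ => ?_
  obtain ⟨A, hA⟩ := hJ θ hθ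
  refine ⟨A, fun n tmin _ hcert => ?_⟩
  obtain ⟨K, t, w, wJ, hat, hwJ, hDD⟩ := hcert
  have hat' : ∀ k, 0 < t k ∧ t k ≤ θ * (n + 1) ∧ 0 ≤ w k :=
    fun k => ⟨(hat k).2.2.1, (hat k).2.1, (hat k).2.2.2⟩
  exact ⟨K, t, w, wJ, hat', hwJ, hA n K t w wJ hat' hwJ hDD, hDD⟩

end Summit.RiemannHypothesis.RiemannHypothesis.Theorems.IntegerScrew.Manifest

end
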